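import Summits.MatrixMultiplication.MatrixMultiplication.Theorems.ObstructionDescentUniversalOccurrenceTwoRectangleTwoRowValue

set_option linter.dupNamespace false
set_option autoImplicit false

/-!
# Universal occurrence — two rectangles, ALL TWO-ROW TYPES, part O: `ν = (2N-2k, 2k)` for all `k ≥ 1` and `m ≥ N ≥ 2k` (decomp-mm · lens 3 · gen 43)

Route `route-MatrixMultiplication-ObstructionDescent` (sub-problem `MatrixMultiplication`, `ω(ℂ) = 2`); SUPPORT for the crux
`NoOccurrenceObstruction` (`P_O`, item `stmt-MatrixMultiplication-29040`) through the universal-occurrence programme (NODE-g29…g43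
of the decomp-mm cell, lens 3).  Nothing here proves `ω = 2` or closes an item; no `def`, no `sorry`, standard axioms.

**Claim** (`occurs_unitTensor_twoRectangle_twoRows`).  For all `k ≥ 1` and `m ≥ N ≥ 2k` the type `((2^N),(2^N),(2N-2k,2k))`
occurs in the coordinate ring of the orbit closure of the unit tensor `⟨m⟩` (in degree `2N`): the WHOLE two-row part of the
two-rectangular sector (Kronecker condition `ν₂ ≤ N`, i.e. `2k ≤ N`) is realised in Lean at and above the floor `m = N`,
uniformly in the two parameters `k, N` — the first two-parameter family of the programme.

**Proof.**  The K23 floor law (`occurs_unitTensor_twoRectangle_of_pairing_ne_zero`, `δ = 2`) with the `k`-pair design (parts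
L–N: pair tableau, colouring with `k` ones at the odd slots `< 2k`, core columns `[(0,s_{2j}),(1,s_{2j})] ‖ [(1,s_{2j+1}),(0,s_{2j+1})]`,
no twist): every term is `[e_T(g ∘ w_σ) ≠ 0]` with `e_T(g ∘ w_σ) ∈ {0,1}` (`twoRow_value_eq_one`, via the parity law), and the
witness `σ₀ = 1`, `σ₁ = ∏_{j<k} (s_{2j} s_{2j+1})` (`twoRow_witness`) makes the sum positive.

[cite: BurgisserIkenmeyer2011, §3.4 (Prop. 3.4), Thm. 4.4] [cite: BurgisserIkenmeyer2017, §5, Thm. 5.9 (proof of (2)), eq. (3.4)]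
[cite: Landsberg2017, §9.1.1]
-/

noncomputable section

open scoped BigOperators

namespace Summit.MatrixMultiplication.MatrixMultiplication.Theorems.ObstructionCalculus

open Literature.Computability.AlgebraicComplexity
open Literature.NumberTheory.DiophantineGeometry

set_option maxHeartbeats 400000 in
/-- **The witness.**  `σ₀ = 1`, `σ₁ = ∏_{j<k} (s_{2j} s_{2j+1})`: `g ∘ w_σ` is the row word of `T`, so `e_T(g ∘ w_σ) = 1 ≠ 0`.
[folklore] -/
theorem twoRow_witness {N k : ℕ} (hN : 2 * k ≤ N) {Y : YoungDiagram}
    (hNY : ∀ x ∈ Y.cells, x.1 < N) (T : StdFilling (N * 2) Y)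
    (hT : ∀ p : Fin (N * 2), T.1 p = (if (p : ℕ) < 4 * k then ((p : ℕ) % 2, (p : ℕ) / 2) else (0, (p : ℕ) - 2 * k)))
    (e : Fin (N * 2) ≃ Fin 2 × Fin N) (g : Fin N → Fin N)
    (hgv : ∀ i : Fin N, ((g i : Fin N) : ℕ) = if ((i : ℕ) < 2 * k ∧ (i : ℕ) % 2 = 1) then 1 else 0)
    (hpos : ∀ (σ : Fin 2 → Equiv.Perm (Fin N)) (n : ℕ) (hn : n < N * 2) (a : Fin 2) (s : Fin N),
      (if (n < 4 * k ∧ n % 4 = 2) then n + 1 else if (n < 4 * k ∧ n % 4 = 3) then n - 1 else n) % 2 = (a : ℕ) →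
      (if (n < 4 * k ∧ n % 4 = 2) then n + 1 else if (n < 4 * k ∧ n % 4 = 3) then n - 1 else n) / 2 = (s : ℕ) →
      (g ∘ fun q => σ (e q).1 (e q).2) ⟨n, hn⟩ = g (σ a s)) :
    ∃ σw : Fin 2 → Equiv.Perm (Fin N),
      T.polytabloid ℂ hNY (g ∘ fun q => σw (e q).1 (e q).2) ≠ 0 := by
  classical
  have hrowT : ∀ q : Fin (N * 2), (T.1 q).1 = if (q : ℕ) < 4 * k then (q : ℕ) % 2 else 0 := fun q => by
    rw [hT]; split_ifs <;> rfl
  obtain ⟨S, hSv⟩ : ∃ S : Fin N → Fin N, ∀ s : Fin N, ((S s : Fin N) : ℕ) =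
      if (s : ℕ) < 2 * k then (if (s : ℕ) % 2 = 0 then (s : ℕ) + 1 else (s : ℕ) - 1) else (s : ℕ) :=
    ⟨fun s => ⟨if (s : ℕ) < 2 * k then (if (s : ℕ) % 2 = 0 then (s : ℕ) + 1 else (s : ℕ) - 1) else (s : ℕ),
      by have := s.2; split_ifs <;> omega⟩, fun s => rfl⟩
  have hSi : Function.Involutive S := by
    intro s; apply Fin.ext; rw [hSv, hSv]; split_ifs <;> omega
  obtain ⟨σw, hw0, hw1⟩ : ∃ σw : Fin 2 → Equiv.Perm (Fin N), σw 0 = 1 ∧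
      σw 1 = Function.Involutive.toPerm S hSi :=
    ⟨![1, Function.Involutive.toPerm S hSi], rfl, rfl⟩
  refine ⟨σw, ?_⟩
  have hsw0 : ∀ s : Fin N, ((σw 0 s : Fin N) : ℕ) = (s : ℕ) := by
    intro s; rw [hw0]; rfl
  have hsw1 : ∀ s : Fin N, ((σw 1 s : Fin N) : ℕ) =
      if (s : ℕ) < 2 * k then (if (s : ℕ) % 2 = 0 then (s : ℕ) + 1 else (s : ℕ) - 1) else (s : ℕ) := by
    intro s; rw [hw1]; exact hSv s
  -- `g ∘ w_σ = w_T`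
  have hwrd : (g ∘ fun q => σw (e q).1 (e q).2) = StdFilling.rowWord hNY T := by
    funext q
    obtain ⟨n, hn⟩ := q
    apply Fin.ext
    show _ = (T.1 ⟨n, hn⟩).1
    rw [hrowT]
    dsimp only
    obtain ⟨X, hXdef⟩ : ∃ X : ℕ,
        X = (if (n < 4 * k ∧ n % 4 = 2) then n + 1 else if (n < 4 * k ∧ n % 4 = 3) then n - 1 else n) :=
      ⟨_, rfl⟩
    have hposn := hpos σw n hn
    rw [← hXdef] at hposn
    have hX2 : X < N * 2 := by rw [hXdef]; split_ifs <;> omega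
    rw [hposn ⟨X % 2, by omega⟩ ⟨X / 2, by omega⟩ rfl rfl, hgv]
    rcases Nat.mod_two_eq_zero_or_one X with h | h
    · rw [show (⟨X % 2, by omega⟩ : Fin 2) = 0 from Fin.ext h, hsw0]
      dsimp only
      split_ifs at hXdef ⊢ <;> omega
    · rw [show (⟨X % 2, by omega⟩ : Fin 2) = 1 from Fin.ext h, hsw1]
      dsimp only
      split_ifs at hXdef ⊢ <;> omega
  rw [hwrd, StdFilling.polytabloid_apply_rowWord]
  exact one_ne_zero

set_option maxHeartbeats 400000 in
/-- **`((2^N),(2^N),(2N-2k,2k))` occurs for `⟨m⟩` for all `k ≥ 1` and `m ≥ N ≥ 2k`**, uniformly in `k` and `N`: the whole two-row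
part of the two-rectangular sector. [cite: BurgisserIkenmeyer2011, Thm. 4.4] [cite: BurgisserIkenmeyer2017, Thm. 5.9 (proof of (2))] -/
theorem occurs_unitTensor_twoRectangle_twoRows {N m k : ℕ} (hk : 1 ≤ k) (hN : 2 * k ≤ N) (hNm : N ≤ m)
    {lam : Fin 3 → Nat.Partition (N * 2)} (h0 : lam 0 = Nat.Partition.rectangle N 2)
    (h1 : lam 1 = Nat.Partition.rectangle N 2) (h2 : (lam 2).sortedParts = [2 * N - 2 * k, 2 * k]) :
    isotypicSum₁ (lam 0) (isotypicSum₂ (lam 1) (isotypicSum₃ (lam 2)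
      (kroneckerPow (unitTensor ℂ m) (N * 2)))) ≠ 0 := by
  classical
  -- the shape and the pair tableau `T`
  have hNY : ∀ x ∈ (lam 2).youngDiagram.cells, x.1 < N := fun x hx => by
    have := fst_lt_of_mem_youngDiagram_twoRows (lam 2) h2 hx; omega
  have hd : (lam 2).youngDiagram.cells.card = N * 2 := Nat.Partition.card_cells_youngDiagram _
  obtain ⟨T, hT⟩ : ∃ T : StdFilling (N * 2) (lam 2).youngDiagram, ∀ p : Fin (N * 2), T.1 p =
      (if (p : ℕ) < 4 * k then ((p : ℕ) % 2, (p : ℕ) / 2) else (0, (p : ℕ) - 2 * k)) :=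
    ⟨⟨fun p => if (p : ℕ) < 4 * k then ((p : ℕ) % 2, (p : ℕ) / 2) else (0, (p : ℕ) - 2 * k),
      ⟨fun p => twoRowCell_mem_twoRows hN (lam 2) h2 p p.2,
       fun p q hpq => Fin.ext (twoRowCell_injective hpq),
       fun p q hpq => twoRowCell_standard hpq⟩⟩, fun p => rfl⟩
  have hM : StdFilling.polytabloid ℂ hNY T ∈
      highestWeightSpace (wordRep ℂ N (N * 2)) (Weight.ofPartition N (lam 2)) := by
    rw [← ydWeight_youngDiagram]; exact StdFilling.polytabloid_mem hNY T hd
  -- the slots, the involution `X = ∏_{j<k} (4j+2 4j+3)` of the positions and the block structures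
  obtain ⟨s0, hs0⟩ : ∃ s : Fin N, (s : ℕ) = 0 := ⟨⟨0, by omega⟩, rfl⟩
  obtain ⟨s1, hs1⟩ : ∃ s : Fin N, (s : ℕ) = 1 := ⟨⟨1, by omega⟩, rfl⟩
  obtain ⟨Xf, hXf⟩ : ∃ Xf : Fin (N * 2) → Fin (N * 2), ∀ q : Fin (N * 2), ((Xf q : Fin (N * 2)) : ℕ) =
      (if ((q : ℕ) < 4 * k ∧ (q : ℕ) % 4 = 2) then (q : ℕ) + 1
        else if ((q : ℕ) < 4 * k ∧ (q : ℕ) % 4 = 3) then (q : ℕ) - 1 else (q : ℕ)) :=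
    ⟨fun q => ⟨(if ((q : ℕ) < 4 * k ∧ (q : ℕ) % 4 = 2) then (q : ℕ) + 1
        else if ((q : ℕ) < 4 * k ∧ (q : ℕ) % 4 = 3) then (q : ℕ) - 1 else (q : ℕ)),
      by have := q.2; split_ifs <;> omega⟩, fun q => rfl⟩
  have hXi : Function.Involutive Xf := by
    intro q; apply Fin.ext; rw [hXf, hXf]; split_ifs <;> omega
  obtain ⟨ξ, hξ⟩ : ∃ ξ : Equiv.Perm (Fin (N * 2)), ξ = Function.Involutive.toPerm Xf hXi := ⟨_, rfl⟩
  have hξv : ∀ q : Fin (N * 2), ((ξ q : Fin (N * 2)) : ℕ) =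
      (if ((q : ℕ) < 4 * k ∧ (q : ℕ) % 4 = 2) then (q : ℕ) + 1
        else if ((q : ℕ) < 4 * k ∧ (q : ℕ) % 4 = 3) then (q : ℕ) - 1 else (q : ℕ)) := by
    intro q; rw [hξ]; exact hXf q
  obtain ⟨e, he⟩ : ∃ e : Fin (N * 2) ≃ Fin 2 × Fin N,
      e = ξ.trans (finProdFinEquiv.symm.trans (Equiv.prodComm (Fin N) (Fin 2))) := ⟨_, rfl⟩
  have hev : ∀ q : Fin (N * 2), (((e q).1 : Fin 2) : ℕ) = ((ξ q : Fin (N * 2)) : ℕ) % 2 ∧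
      (((e q).2 : Fin N) : ℕ) = ((ξ q : Fin (N * 2)) : ℕ) / 2 := by
    intro q; rw [he]; simp [Fin.modNat, Fin.divNat]
  -- no twist: `H = ∅`, `e' = e` (as the trivial involution)
  obtain ⟨H, hH⟩ : ∃ H : Finset (Fin N), H = ∅ := ⟨_, rfl⟩
  have hHv : ∀ s : Fin N, s ∈ H ↔ False := by intro s; rw [hH]; simp
  let F : Fin 2 × Fin N → Fin 2 × Fin N := fun x => (if x.2 ∈ H then Fin.rev x.1 else x.1, x.2)
  have hF : Function.Involutive F := by
    rintro ⟨a, s⟩; by_cases hs : s ∈ H <;> simp [F, hs, Fin.rev_rev]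
  obtain ⟨e', he'⟩ : ∃ e' : Fin (N * 2) ≃ Fin 2 × Fin N,
      ∀ q, e' q = (if (e q).2 ∈ H then Fin.rev (e q).1 else (e q).1, (e q).2) :=
    ⟨e.trans (Function.Involutive.toPerm F hF), fun q => rfl⟩
  -- the colouring `g = (0,1,0,1,…,0,1,0,0,…)` (`k` ones)
  obtain ⟨g, hg⟩ : ∃ g : Fin N → Fin N, ∀ i, g i = if ((i : ℕ) < 2 * k ∧ (i : ℕ) % 2 = 1) then s1 else s0 :=
    ⟨_, fun i => rfl⟩
  have hgv : ∀ i : Fin N, ((g i : Fin N) : ℕ) = if ((i : ℕ) < 2 * k ∧ (i : ℕ) % 2 = 1) then 1 else 0 := by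
    intro i; rw [hg]; split_ifs <;> omega
  -- evaluation of the words `g ∘ w_σ` at the positions
  have hpos : ∀ (σ : Fin 2 → Equiv.Perm (Fin N)) (n : ℕ) (hn : n < N * 2) (a : Fin 2) (s : Fin N),
      (if (n < 4 * k ∧ n % 4 = 2) then n + 1 else if (n < 4 * k ∧ n % 4 = 3) then n - 1 else n) % 2 = (a : ℕ) →
      (if (n < 4 * k ∧ n % 4 = 2) then n + 1 else if (n < 4 * k ∧ n % 4 = 3) then n - 1 else n) / 2 = (s : ℕ) →
      (g ∘ fun q => σ (e q).1 (e q).2) ⟨n, hn⟩ = g (σ a s) := by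
    intro σ n hn a s ha hs
    obtain ⟨h1, h2⟩ := hev ⟨n, hn⟩
    rw [hξv] at h1 h2
    dsimp only at h1 h2
    have ha' : (e ⟨n, hn⟩).1 = a := Fin.ext (by rw [h1, ha])
    have hs' : (e ⟨n, hn⟩).2 = s := Fin.ext (by rw [h2, hs])
    show g (σ (e ⟨n, hn⟩).1 (e ⟨n, hn⟩).2) = _
    rw [ha', hs']
  -- the summands are `0` or `1`
  have hterm : ∀ σ : Fin 2 → Equiv.Perm (Fin N),
      (∏ a, ((Equiv.Perm.sign (σ a) : ℤ) : ℂ)) *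
          (wordBlockSign ℂ e' (fun q => σ (e q).1 (e q).2) *
            ∑ w, StdFilling.polytabloid ℂ hNY T w *
              ∏ q, (fun i l : Fin N => if l = g i then (1 : ℂ) else 0) (σ (e q).1 (e q).2) (w q)) =
        if StdFilling.polytabloid ℂ hNY T (g ∘ fun q => σ (e q).1 (e q).2) ≠ 0 then 1 else 0 := by
    intro σ
    have hc : (∑ w, StdFilling.polytabloid ℂ hNY T w *
        ∏ q, (fun i l : Fin N => if l = g i then (1 : ℂ) else 0) (σ (e q).1 (e q).2) (w q)) =
        StdFilling.polytabloid ℂ hNY T (g ∘ fun q => σ (e q).1 (e q).2) :=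
      sum_mul_prod_indicator_eq _ g _
    have hval : ∀ s, (σ 0)⁻¹ (σ 1 s) ∈ H ↔ s ∈ H := fun s => by rw [hHv, hHv]
    rw [hc, ← mul_assoc, sign_mul_wordBlockSign_twist e e' H he' σ, if_pos hval, one_mul]
    by_cases hz : StdFilling.polytabloid ℂ hNY T (g ∘ fun q => σ (e q).1 (e q).2) = 0
    · rw [if_neg (fun h => h hz), hz]
    · rw [if_pos hz]
      exact twoRow_value_eq_one hN hNY T hT e g hgv hpos σ hz
  refine occurs_unitTensor_twoRectangle_of_pairing_ne_zero hNm e e' h0 h1 hM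
    (fun i l => if l = g i then (1 : ℂ) else 0) ?_
  intro hsum
  rw [Finset.sum_congr rfl (fun σ _ => hterm σ), Finset.sum_boole, Nat.cast_eq_zero,
    Finset.card_eq_zero, Finset.filter_eq_empty_iff] at hsum
  obtain ⟨σw, hne⟩ := twoRow_witness hN hNY T hT e g hgv hpos
  exact hsum (Finset.mem_univ σw) hne

end Summit.MatrixMultiplication.MatrixMultiplication.Theorems.ObstructionCalculus
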